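import Summits.BirchSwinnertonDyer.BirchSwinnertonDyer.Theorems.SignedBaseChangeAnticyclotomicEisensteinDivisibilityAdmdefChebSplitTarget
import Summits.BirchSwinnertonDyer.BirchSwinnertonDyer.Theorems.SignedBaseChangeAnticyclotomicEisensteinDivisibilityAdmdefChebSplit
import Summits.BirchSwinnertonDyer.BirchSwinnertonDyer.Theorems.AdditiveKolyvaginRoadLocalEquiv
import Summits.BirchSwinnertonDyer.BirchSwinnertonDyer.Theorems.SignedBaseChangeAnticyclotomicEisensteinDivisibilityAdmdefOddSelmerDim
import Summits.BirchSwinnertonDyer.BirchSwinnertonDyer.Theorems.KolyvaginRoadThreeMethod2LocalFrobenius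
import Literature.NumberTheory.EllipticCurves.AnticyclotomicInertPrimeTotallySplitProofs
import Literature.NumberTheory.EllipticCurves.HeegnerPointsKolyvaginCebotarevProofs
import Literature.NumberTheory.EllipticCurves.SubgroupSelmerCocycleCriteriaProofs
import Literature.NumberTheory.EllipticCurves.HeegnerModuleIndex
import HarnessLib

/-!
# Line `admdef`: a NON-ZERO bottom class is VISIBLE at an admissible Frobenius of `Gal(K̄/K_∞)` — the Čebotarev half of
# the non-primitive locus (NP) (crux `AnticyclotomicEisensteinDivisibility`, stmt-BirchSwinnertonDyer-20727; LEAD seat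
# bsd-line-sbc-p1 gen 23, `--supports stmt-BirchSwinnertonDyer-20727`)

WHY THIS FILE.  Since v16 (LEAD gen 21) the line `admdef` asks its research stubs only on the NON-PRIMITIVE LOCUS (NP)
`Signdetour.RootInvisibleNS`: «some pinned `+` tuple has bottom class `z_{0,1} ∈ H¹(K, E[p])` whose restriction to `⟨φ⟩`
VANISHES for every arithmetic Frobenius `φ ∈ D_𝔓 ∩ Gal(K̄/K_∞)`, every prime `𝔓` of `K̄` over every place `v ∋ q`, every
Bertolini–Darmon `1`-admissible `q`» — the shape in which the typed second reciprocity law of CHKLL25 Thm. 7.4 reads the class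
(`unrLoc`), and the hypothesis of the registered stubs (RV₁) `stub_rootVisibleRankOne` (conclusion `¬ RootInvisibleNS`),
(Anch∃)FW/¬FW and (γ′)_NP.  The line files READ this clause as «`z_{0,1} = 0`» (Čebotarev); THIS FILE PROVES that reading in
kernel, for ANY class:

* `exists_admissibleFrob_resOfLe_ne_zero` — on the cell-β frame (`p ≥ 5`, `ρ̄_{E,p}` onto, `K` imaginary quadratic, `N_E`
  Heegner in `K`, `p` split in `K`, `κ` anticyclotomic) EVERY non-zero `x ∈ H¹(K, E[p]) = H¹(Γ_{K_0}, E[p])` has NON-ZERO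
  restriction to `⟨φ⟩` for some arithmetic Frobenius `φ ∈ D_𝔓 ∩ ker κ` at some prime `𝔓 ∣ v ∋ q`, `q` `1`-admissible;
* `eq_zero_of_forall_admissibleFrob_resOfLe_eq_zero` — contrapositive, in the exact binder shape of the (NP) clause: a class
  invisible at every admissible Frobenius of `Gal(K̄/K_∞)` IS ZERO.  Hence (NP) for a pinned tuple ⟺ its bottom class
  vanishes, and (RV₁) reads «`dim_𝔽p Sel_p(E/K)[p] = 1 ⟹ z_{0,1} ≠ 0` for every pinned `+` tuple».

PROOF (all inputs kernel theorems of the tree).  Transport `x` to `X ∈ H¹(Γ_K, E[p])` along `Γ_K = Γ_{K_0}` (`κ.layerSubgroup 0 = ⊤`;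
explicit cocycles, `map_oneCocycleClass`).  With complex conjugation `c` (`c² = 1`) one of `X ± c_* X` is a NON-ZERO `c`-eigenclass
`Y` (`2` and `p` kill `X` only if `X = 0`, `p` odd).  Čebotarev with the sign on β (`…AdmdefChebSplit.exists_admissible_loc_ne_zero_of_target`
fed with `…AdmdefChebSplitTarget.exists_admissible_target_of_split`; Zha14 Lemma 7.3 / BD05 Thm. 3.2) gives an admissible `q`
OUTSIDE the finite set of residue characteristics of the ramification places of `X` and of the bad places, and `v ∋ q` with
`loc_v Y ≠ 0`; since `c_*` acts on `loc_v` by the scalar `ε_q` (`AdditiveKoly.localEquiv_of_admQ`, Zha14 (9.2)), `loc_v X ≠ 0`.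
At the prime `𝔓 = 𝔓_{ι₀,𝔐}` over `v` cut out by the embedding, `X` is unramified and `I_𝔓` fixes `E[p]`, so for an arithmetic
Frobenius `F` at `𝔓` (`exists_isArithFrobAt_of_mem_primesAbove_holds`) Gross's criterion in its non-trivial-Frobenius form
(`LocalFrob.oneCocycleClass_mem_torsionLocalKer_iff_apply_frob`, Gross 1991 Prop. 9.6) says `loc_v X = 0 ⟺ X(F) ∈ (F − 1)E[p]`;
and `F ∈ ker κ` because `κ` vanishes at every Frobenius above the inert principal prime `(q)` of the anticyclotomic tower
(`ZpExtension.apply_eq_frobExponentAt_of_isArithFrobAt`, `frobExponentAt_eq_zero_of_span_natCast`).  Finally `res_{⟨F⟩} x = 0`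
says exactly `x(F) ∈ (F − 1)E[p]` (`CocycleCriteria.resOfLe_oneCocycleClass_eq_zero_iff`).

HONEST FRAMING: kernel Galois cohomology over the tree's predicates; no named fact is consumed; (NP), (RV₁), the anchor stubs,
the crux and BSD are NOT proved — the file only identifies the (NP) clause with the vanishing of the bottom class.

References: [cite: WZhang2014, Lemma 7.3, §9 (9.2)] [cite: BertoliniDarmon2005, Thm. 3.2] [cite: GrossLMS1991, Prop. 9.6, §5 (5.1)]
[cite: CastellaEtAl2025, Thm. 7.4 (second law) (arXiv:2308.10474v2 p0030 L50–L52)] [cite: SerreGaloisCohomology1997, I.§2.4–2.5, I.§5.1]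
[cite: Washington1997, Prop. 13.2].
-/

-- D-0017: single-problem summit, the namespace repeats the problem name by design.
set_option linter.dupNamespace false
set_option autoImplicit false

noncomputable section

open scoped Classical NumberField

namespace Summit.BirchSwinnertonDyer.BirchSwinnertonDyer.Theorems.SignedBaseChangeAcDivAdmdefRootZero

open WeierstrassCurve NumberField IsDedekindDomain Field Module
  Literature.NumberTheory.EllipticCurves Literature.NumberTheory.GaloisRepresentations
  Literature.NumberTheory.EllipticCurves.BertoliniDarmon2005
  Summit.BirchSwinnertonDyer.BirchSwinnertonDyer.Theorems Summit.BirchSwinnertonDyer.BirchSwinnertonDyer.Theorems.AdditiveKoly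
  Summit.BirchSwinnertonDyer.Rank1Residual.X11b.Three.Koly.Method2

/-! ## §1 Small bricks -/

/-- The rational prime below a place `v ∋ q` is `q` (`= absNorm (v ∩ ℤ)`). [folklore] -/
private theorem eq_absNorm_under_of_natCast_mem {K : Type} [Field K] [NumberField K] (v : HeightOneSpectrum (𝓞 K)) {q : ℕ} (hq : q.Prime)
    (hqv : (q : 𝓞 K) ∈ v.asIdeal) : q = Ideal.absNorm (v.asIdeal.under ℤ) := by
  haveI : NeZero v.asIdeal := ⟨v.ne_bot⟩
  have hdvd : Ideal.absNorm (v.asIdeal.under ℤ) ∣ q :=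
    Int.natCast_dvd_natCast.1 (Int.cast_mem_ideal_iff.1 (by simpa using hqv))
  exact ((Nat.prime_dvd_prime_iff_eq (Nat.absNorm_under_prime v.asIdeal) hq).1 hdvd).symm

/-- A place containing an inert rational prime `q` IS `(q)`. [folklore] -/
private theorem asIdeal_eq_span_of_mem {K : Type} [Field K] [NumberField K] {q : ℕ} (hq0 : q ≠ 0) (hqP : (Ideal.span {((q : ℕ) : 𝓞 K)}).IsPrime)
    (v : HeightOneSpectrum (𝓞 K)) (hqv : (q : 𝓞 K) ∈ v.asIdeal) : v.asIdeal = Ideal.span {((q : ℕ) : 𝓞 K)} := by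
  have hbot : Ideal.span {((q : ℕ) : 𝓞 K)} ≠ ⊥ := by
    rw [Ne, Ideal.span_singleton_eq_bot]; exact_mod_cast hq0
  exact ((hqP.isMaximal hbot).eq_of_le v.isPrime.ne_top ((Ideal.span_singleton_le_iff_mem _).mpr hqv)).symm

/-- Complex conjugation exists: an imaginary quadratic field has an automorphism `≠ 1` (`|Aut(K/ℚ)| = 2`; copy of
`AdditiveKoly.exists_algEquiv_ne_one_of_isImaginaryQuadratic`, re-proved here to keep this file out of the AKR route cone). [folklore] -/
private theorem exists_algEquiv_ne_one {K : Type} [Field K] [NumberField K] (hK : IsImaginaryQuadratic K) :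
    ∃ c : K ≃ₐ[ℚ] K, c ≠ 1 := by
  -- adapted from Theorems/AdditiveKolyvaginRoadKolyvaginPrimitiveOfLevelSystems.lean (l.47–53)
  haveI : Algebra.IsQuadraticExtension ℚ K := ⟨hK.1⟩
  have hcard : Nat.card (K ≃ₐ[ℚ] K) = 2 := by rw [IsGalois.card_aut_eq_finrank, hK.1]
  haveI : Finite (K ≃ₐ[ℚ] K) := Nat.finite_of_card_ne_zero (by rw [hcard]; decide)
  haveI : Nontrivial (K ≃ₐ[ℚ] K) := Finite.one_lt_card_iff_nontrivial.mp (by rw [hcard]; decide)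
  exact exists_ne 1

/-! ## §2 Transport `H¹(Γ_{K_0}, E[p]) → H¹(Γ_K, E[p])`: every element of `Γ_K` lies in the bottom layer -/

/-- Every element of `Γ_K` lies in the bottom layer `Γ_{K_0} = κ⁻¹(p⁰ℤ_p)` (`ZpExtension.layerSubgroup_zero`). [folklore] -/
theorem mem_layerSubgroup_zero {K : Type} [Field K] [NumberField K] {p : ℕ} [Fact p.Prime] (κ : ZpExtension K p)
    (g : absoluteGaloisGroup K) :
    g ∈ κ.layerSubgroup 0 := by
  rw [ZpExtension.layerSubgroup_zero]; exact Subgroup.mem_top g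

/-! ## §3 Čebotarev with the sign on cell β, for an arbitrary non-zero class -/

variable (W : WeierstrassCurve ℚ) (K : Type) [Field K] [NumberField K] (p : ℕ) [W.IsElliptic] [W.IsGloballyMinimal] [Fact p.Prime]


/-- **Čebotarev with the sign for an EIGENCLASS, no Selmer hypothesis** — `…AdmdefChebSplit.exists_admissible_loc_ne_zero_of_target` fed with
`…AdmdefChebSplitTarget.exists_admissible_target_of_split` (the body of `…AdmdefSelmerWalk.localCheb_of_admQ_of_split` with the Selmer
membership replaced by the bare eigen-condition it uses).  [cite: WZhang2014, Lemma 7.3] [cite: BertoliniDarmon2005, Thm. 3.2] -/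
theorem exists_admissible_torsionLocMap_ne_zero_of_eigen (h5 : 5 ≤ p) (hsurj : W.HasSurjectiveModNGaloisRep p)
    (hK : IsImaginaryQuadratic K) (hH : SatisfiesHeegnerHypothesis (W.conductorNorm ℤ) K)
    (hsp : ((Ideal.span {(p : ℤ)}).primesOver (𝓞 K)).ncard = 2) {c : K ≃ₐ[ℚ] K} (hc1 : c ≠ 1) (μ : Bool) (x : Vp W K p)
    (hxν : conjAct W c ((p ^ 1 : ℕ) : ℤ) x = sgnP μ • x) (hx0 : x ≠ 0) (B₀ : Finset ℕ) :
    ∃ q : ℕ, q ∉ B₀ ∧ IsAdmissiblePrime (W.conductorNorm ℤ) K (fun ℓ ↦ W.frobeniusTrace ℓ) p 1 q ∧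
      ∃ v : HeightOneSpectrum (𝓞 K), ((q : ℕ) : 𝓞 K) ∈ v.asIdeal ∧
        (W.baseChange K).torsionLocMap (v.adicCompletion K) ((p ^ 1 : ℕ) : ℤ) x ≠ 0 := by
  -- adapted from Theorems/…AdmdefSelmerWalk.lean `localCheb_of_admQ_of_split`
  have hp : p.Prime := Fact.out
  haveI : Fact (Nat.Prime (p ^ 1)) := ⟨by rw [pow_one]; exact hp⟩
  have h5' : 5 ≤ p ^ 1 := by rw [pow_one]; exact h5
  have hsp' : ((Ideal.span {((p ^ 1 : ℕ) : ℤ)}).primesOver (𝓞 K)).ncard = 2 := by rw [pow_one]; exact hsp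
  have hsurj' : W.HasSurjectiveModNGaloisRep ((p ^ 1 : ℕ) : ℤ) := by rw [Nat.pow_one]; exact hsurj
  have hν : sgnP μ = 1 ∨ sgnP μ = -1 := by cases μ <;> simp [sgnP]
  obtain ⟨q, hqB, hadm, v, hqv, hloc⟩ :=
    SignedBaseChangeAcDivAdmdefChebSplit.exists_admissible_loc_ne_zero_of_target W K (p := p ^ 1) h5' hK hsurj' hc1 hν
      (fun ht hinv ↦ SignedBaseChangeAcDivAdmdefChebSplit.exists_admissible_target_of_split W K (p := p ^ 1) h5' hK hsurj' hsp'
        hH ht hinv hν)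
      hx0 hxν B₀
  rw [Nat.pow_one] at hadm
  exact ⟨q, hqB, hadm, v, hqv, fun h0 ↦ hloc h0⟩

/-- **Čebotarev with the sign for ANY non-zero class** (no eigen-condition): split `X` into `X ± c_* X`; one of them is a non-zero eigenclass
(`p` odd), and `c_*` acts on the localisation at the place above an admissible `q` by the SCALAR `ε_q` (`AdditiveKoly.localEquiv_of_admQ`), so
`loc_v X = 0` would force `loc_v (X ± c_* X) = 0`.  [cite: WZhang2014, Lemma 7.3, §9 (9.2)] [cite: GrossLMS1991, §5 (5.1)] -/
theorem exists_admissible_torsionLocMap_ne_zero (h5 : 5 ≤ p) (hsurj : W.HasSurjectiveModNGaloisRep p)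
    (hK : IsImaginaryQuadratic K) (hH : SatisfiesHeegnerHypothesis (W.conductorNorm ℤ) K)
    (hsp : ((Ideal.span {(p : ℤ)}).primesOver (𝓞 K)).ncard = 2) (X : Vp W K p) (hX : X ≠ 0) (B₀ : Finset ℕ) :
    ∃ q : ℕ, q ∉ B₀ ∧ IsAdmissiblePrime (W.conductorNorm ℤ) K (fun ℓ ↦ W.frobeniusTrace ℓ) p 1 q ∧
      ∃ v : HeightOneSpectrum (𝓞 K), ((q : ℕ) : 𝓞 K) ∈ v.asIdeal ∧
        (W.baseChange K).torsionLocMap (v.adicCompletion K) ((p ^ 1 : ℕ) : ℤ) X ≠ 0 := by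
  have hp : p.Prime := Fact.out
  obtain ⟨c, hc1⟩ := exists_algEquiv_ne_one hK
  have hcc : c * c = 1 := SignedBaseChangeAcDivAdmdefOddSelmerDim.algEquiv_mul_self_eq_one_of_ne_one hK.1 hc1
  set C := conjAct W c ((p ^ 1 : ℕ) : ℤ) with hC
  have hCC : ∀ y : Vp W K p, C (C y) = y := fun y ↦ conjAct_conjAct_of_mul_self W hcc _ y
  -- one of the two eigen-components `X ± C X` is non-zero
  have hsplit : ∃ μ : Bool, X + sgnP μ • C X ≠ 0 := by
    by_contra h
    push Not at h
    have hplus : X + (1 : ℤ) • C X = 0 := by simpa [sgnP] using h true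
    have hminus : X + (-1 : ℤ) • C X = 0 := by simpa [sgnP] using h false
    have hXX : X + X = 0 := by
      have e : X + (1 : ℤ) • C X + (X + (-1 : ℤ) • C X) = X + X := by
        rw [one_zsmul, neg_one_zsmul]; abel
      rw [← e, hplus, hminus, add_zero]
    have hpX : ((p ^ 1 : ℕ) : ℤ) • X = 0 := zsmul_galH1Torsion_eq_zero (W.baseChange K) _ X
    rw [natCast_zsmul] at hpX
    obtain ⟨k, hk⟩ := hp.odd_of_ne_two (by omega)
    have hk1 : p ^ 1 = k * 2 + 1 := by rw [pow_one, hk]; ring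
    have e : (p ^ 1) • X = (k * 2 + 1) • X := congrArg (fun t : ℕ ↦ t • X) hk1
    rw [e, succ_nsmul, mul_nsmul', two_nsmul, hXX, nsmul_zero, zero_add] at hpX
    exact hX hpX
  obtain ⟨μ, hY⟩ := hsplit
  set Y := X + sgnP μ • C X with hYdef
  have hYν : C Y = sgnP μ • Y := by
    have h1 : C Y = C X + sgnP μ • X := by rw [hYdef, map_add, map_zsmul, hCC]
    rw [h1, hYdef]
    cases μ <;> (simp only [sgnP, Bool.false_eq_true, if_false, if_true, one_zsmul, neg_one_zsmul]; abel)
  obtain ⟨q, hqB, hadm, v, hqv, hloc⟩ :=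
    exists_admissible_torsionLocMap_ne_zero_of_eigen W K p h5 hsurj hK hH hsp hc1 μ Y hYν hY B₀
  refine ⟨q, hqB, hadm, v, hqv, fun hX0 ↦ hloc ?_⟩
  -- `c_*` acts on `loc_v` by a scalar, so `loc_v X = 0 ⟹ loc_v Y = 0`
  obtain ⟨s, hs⟩ := localEquiv_of_admQ W K p hK.1 hc1 ⟨q, hadm⟩
  rw [hYdef, map_add, map_zsmul, hs v hqv X, hX0, zsmul_zero, zsmul_zero, add_zero]

/-! ## §4 The theorem -/

section Main

variable {W K p}

/-- **A non-zero class of `H¹(K_0, E[p])` is visible at an admissible Frobenius of `Gal(K̄/K_∞)`.**  Frame: `p ≥ 5`, `ρ̄_{E,p}` onto,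
`K` imaginary quadratic, every `ℓ ∣ N_E` split in `K`, `p` split in `K`, `κ` an ANTICYCLOTOMIC `ℤ_p`-extension.  For every non-zero
`x ∈ H¹(Γ_{K_0}, E[p])` (`Γ_{K_0} = κ.layerSubgroup 0 = Γ_K`, coefficients `E[p] = geomTorsion (p¹)`) there are a Bertolini–Darmon
`1`-admissible prime `q`, the place `v = (q)` of `K`, a prime `𝔓 ∣ v` of `K̄` and an arithmetic Frobenius `φ` at `𝔓` with
`φ ∈ D_𝔓 ∩ ker κ` such that `res_{⟨φ⟩} x ≠ 0` in `H¹(⟨φ⟩, E[p])`.  [cite: WZhang2014, Lemma 7.3, §9 (9.2)] [cite: BertoliniDarmon2005, Thm. 3.2]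
[cite: GrossLMS1991, Prop. 9.6] [cite: Washington1997, Prop. 13.2] -/
theorem exists_admissibleFrob_resOfLe_ne_zero (h5 : 5 ≤ p) (hsurj : W.HasSurjectiveModNGaloisRep p)
    (hK : IsImaginaryQuadratic K) (hH : SatisfiesHeegnerHypothesis (W.conductorNorm ℤ) K)
    (hsp : ((Ideal.span {(p : ℤ)}).primesOver (𝓞 K)).ncard = 2) (κ : ZpExtension K p) (hκ : κ.IsAnticyclotomic)
    (x : (W.baseChange K).torsionH1Over ((p : ℤ) ^ 1) (κ.layerSubgroup 0)) (hx : x ≠ 0) :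
    ∃ q : ℕ, IsAdmissiblePrime (W.conductorNorm ℤ) K (fun ℓ ↦ W.frobeniusTrace ℓ) p 1 q ∧
      ∃ v : HeightOneSpectrum (𝓞 K), ((q : ℕ) : 𝓞 K) ∈ v.asIdeal ∧ ∃ 𝔓 ∈ v.primesAbove,
        ∃ (φ : absoluteGaloisGroup K) (hφ : φ ∈ κ.kerSubgroup),
          φ ∈ 𝔓.decompositionSubgroup (absoluteGaloisGroup K) ∧ IsArithFrobAt (𝓞 K) φ 𝔓 ∧
          resOfLe (geomTorsion (W.baseChange K) ((p : ℤ) ^ 1))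
            ((Subgroup.zpowers_le.mpr hφ).trans (κ.kerSubgroup_le_layerSubgroup 0)) x ≠ 0 := by
  have hp : p.Prime := Fact.out
  -- the coefficient module and an explicit cocycle for `x`
  set M := geomTorsion (W.baseChange K) ((p : ℤ) ^ 1) with hM
  obtain ⟨b, hb⟩ := oneCocycleClass_surjective (discreteTopRep (κ.layerSubgroup 0) M) x
  -- transport to `Γ_K`
  let ι : absoluteGaloisGroup K →ₜ* κ.layerSubgroup 0 :=
    { toFun := fun g ↦ ⟨g, mem_layerSubgroup_zero κ g⟩
      map_one' := rfl
      map_mul' := fun _ _ ↦ rfl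
      continuous_toFun := continuous_id.subtype_mk _ }
  have hιapp : ∀ g : absoluteGaloisGroup K, ((ι g : κ.layerSubgroup 0) : absoluteGaloisGroup K) = g := fun _ ↦ rfl
  have hιc : ∀ (g : absoluteGaloisGroup K) (m : M), AddMonoidHom.id M (ι g • m) = g • AddMonoidHom.id M m := fun _ _ ↦ rfl
  set ψ : contOneCocycles (discreteTopRep (absoluteGaloisGroup K) M) :=
    contOneCocycles.pullback ι (resHomOfEquivariant ι (AddMonoidHom.id M) hιc) b with hψdef
  have hψ : ∀ g : absoluteGaloisGroup K, ψ.1 g = b.1 (ι g) := fun g ↦ rfl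
  set X : Vp W K p := oneCocycleClass _ ψ with hXdef
  -- `X ≠ 0`
  have hX : X ≠ 0 := by
    intro h0
    obtain ⟨a, ha⟩ := (oneCocycleClass_eq_zero_iff _ ψ).mp h0
    apply hx
    rw [← hb, oneCocycleClass_eq_zero_iff]
    refine ⟨a, fun s ↦ ?_⟩
    have hs : s = ι (s : absoluteGaloisGroup K) := Subtype.ext rfl
    have := ha (s : absoluteGaloisGroup K)
    rw [hψ, ← hs, discreteTopRep_ρ_apply] at this
    rw [discreteTopRep_ρ_apply]
    exact this
  -- the finite exceptional set: ramification places of `X` and bad places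
  have hn0 : ((p ^ 1 : ℕ) : ℤ) ≠ 0 := by exact_mod_cast (pow_pos hp.pos 1).ne'
  obtain ⟨Tx, hTxfin, hTx⟩ := exists_finite_forall_mem_unramifiedKer (W.baseChange K) (n := ((p ^ 1 : ℕ) : ℤ)) hn0 X
  have hbad : ((W.baseChange K).badPlaces (𝓞 K)).Finite := (W.baseChange K).finite_badPlaces_holds (𝓞 K)
  set B₀ : Finset ℕ := (hTxfin.union hbad).toFinset.image (fun w : HeightOneSpectrum (𝓞 K) ↦ Ideal.absNorm (w.asIdeal.under ℤ))
    with hB₀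
  -- Čebotarev
  obtain ⟨q, hqB, hadm, v, hqv, hloc⟩ := exists_admissible_torsionLocMap_ne_zero W K p h5 hsurj hK hH hsp X hX B₀
  have hq : q.Prime := hadm.1
  have hvTB : v ∉ Tx ∪ (W.baseChange K).badPlaces (𝓞 K) := by
    intro hv
    apply hqB
    rw [hB₀, Finset.mem_image]
    exact ⟨v, (hTxfin.union hbad).mem_toFinset.mpr hv, (eq_absNorm_under_of_natCast_mem v hq hqv).symm⟩
  have hvT : v ∉ Tx := fun h ↦ hvTB (Or.inl h)
  have hvbad : v ∉ (W.baseChange K).badPlaces (𝓞 K) := fun h ↦ hvTB (Or.inr h)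
  -- `q ≠ p`, so `p ∉ v`
  have hqp : q ≠ p := by
    intro h
    exact hadm.2.1 (h ▸ dvd_mul_right q _)
  have hpv : ((p : ℕ) : 𝓞 K) ∉ v.asIdeal := not_natCast_mem_of_prime_ne hq hp hqp v hqv
  have hpv' : ((((p ^ 1 : ℕ) : ℤ)) : 𝓞 K) ∉ v.asIdeal := by
    rw [Int.cast_natCast, Nat.pow_one]; exact hpv
  -- the prime of `K̄` over `v` cut out by the embedding, a Frobenius there, and its membership in `ker κ`
  haveI : CharZero (v.adicCompletion K) :=
    charZero_of_injective_algebraMap (algebraMap K (v.adicCompletion K)).injective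
  obtain ⟨𝔐, h𝔐⟩ := v.localPrimesAbove_nonempty
  set 𝔓 := v.primeBelow (closureEmb (K := K) (v.adicCompletion K)) 𝔐 with h𝔓def
  have h𝔓 : 𝔓 ∈ v.primesAbove := v.primeBelow_mem_primesAbove h𝔐
  haveI : 𝔓.IsPrime := h𝔓.1
  obtain ⟨F, hF⟩ := HeightOneSpectrum.exists_isArithFrobAt_of_mem_primesAbove_holds h𝔓
  have hFD : F ∈ 𝔓.decompositionSubgroup (absoluteGaloisGroup K) := hF.mem_stabilizer
  have hspan : v.asIdeal = Ideal.span {((q : ℕ) : 𝓞 K)} := asIdeal_eq_span_of_mem hq.ne_zero hadm.2.2.1 v hqv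
  have hFker : F ∈ κ.kerSubgroup := by
    rw [ZpExtension.mem_kerSubgroup, κ.apply_eq_frobExponentAt_of_isArithFrobAt hpv h𝔓 hF,
      κ.frobExponentAt_eq_zero_of_span_natCast hK hκ hpv hspan, ofAdd_zero]
  -- inertia at `𝔓` fixes `E[p]`, and `ψ` vanishes on it (`X` is unramified at `𝔓`)
  have hI : 𝔓.inertia (absoluteGaloisGroup K) ≤ torsionFixing (W.baseChange K) ((p ^ 1 : ℕ) : ℤ) :=
    inertia_le_torsionFixing (W.baseChange K) hvbad hpv' _ h𝔐
  have hψI : ∀ i ∈ 𝔓.inertia (absoluteGaloisGroup K), ψ.1 i = 0 := by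
    have hx' : oneCocycleClass _ ψ ∈ unramifiedKer (geomTorsion (W.baseChange K) ((p ^ 1 : ℕ) : ℤ)) 𝔓 := hTx v hvT 𝔓 h𝔓
    obtain ⟨a, ha⟩ := (oneCocycleClass_mem_subgroupResKer_iff _ ψ).mp hx'
    intro i hi
    rw [ha ⟨i, hi⟩]
    exact sub_eq_zero.mpr (smul_eq_of_mem_torsionFixing (W.baseChange K) _ (hI hi) a)
  -- conclusion
  refine ⟨q, hadm, v, hqv, 𝔓, h𝔓, F, hFker, hFD, hF, fun hres ↦ hloc ?_⟩
  -- `res_{⟨F⟩} x = 0` says `b(F) = F a − a`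
  rw [← hb] at hres
  obtain ⟨a, ha⟩ := (CocycleCriteria.resOfLe_oneCocycleClass_eq_zero_iff _ b).mp hres
  have hbF : ψ.1 F = F • a - a := by
    have h := ha ⟨F, Subgroup.mem_zpowers F⟩
    have hincl : (Subgroup.inclusion ((Subgroup.zpowers_le.mpr hFker).trans (κ.kerSubgroup_le_layerSubgroup 0))
        ⟨F, Subgroup.mem_zpowers F⟩ : κ.layerSubgroup 0) = ι F := Subtype.ext rfl
    rw [hincl] at h
    rw [hψ]
    exact h
  -- Gross's criterion at the non-trivial Frobenius `F`
  have hcrit := LocalFrob.oneCocycleClass_mem_torsionLocalKer_iff_apply_frob (W.baseChange K) (n := p ^ 1)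
    (pow_pos hp.pos 1).ne' h𝔐 hF hI ψ hψI
  exact hcrit.mpr ⟨a, hbF⟩

/-- **The (NP) clause for a class IS its vanishing** (binder shape of `Signdetour.RootInvisibleNS` / of the registered stubs' hypothesis,
at a level `N = N_E`): if `x ∈ H¹(Γ_{K_0}, E[p])` restricts to zero on `⟨φ⟩` for every arithmetic Frobenius `φ ∈ D_𝔓 ∩ Gal(K̄/K_∞)`,
every `𝔓 ∣ v ∋ q`, every `1`-admissible `q`, then `x = 0`.  So a pinned `+` tuple witnesses (NP) iff its bottom class `z_{0,1}`
vanishes, and (RV₁) reads «`dim Sel_p(E/K)[p] = 1 ⟹ z_{0,1} ≠ 0`».  [cite: WZhang2014, Lemma 7.3] [cite: GrossLMS1991, Prop. 9.6]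
[cite: CastellaEtAl2025, Thm. 7.4 (second law) (arXiv:2308.10474v2 p0030 L50–L52)] -/
theorem eq_zero_of_forall_admissibleFrob_resOfLe_eq_zero {N : ℕ} (hN : (N : ℤ) = W.conductorNorm ℤ) (h5 : 5 ≤ p)
    (hsurj : W.HasSurjectiveModNGaloisRep p) (hK : IsImaginaryQuadratic K)
    (hHeeg : ∀ ℓ : ℕ, ℓ.Prime → ℓ ∣ N → ((Ideal.span {(ℓ : ℤ)}).primesOver (𝓞 K)).ncard = 2)
    (hsp : ((Ideal.span {(p : ℤ)}).primesOver (𝓞 K)).ncard = 2) (κ : ZpExtension K p) (hκ : κ.IsAnticyclotomic)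
    (x : (W.baseChange K).torsionH1Over ((p : ℤ) ^ 1) (κ.layerSubgroup 0))
    (hinv : ∀ (q : ℕ), IsAdmissiblePrime N K (fun ℓ ↦ W.frobeniusTrace ℓ) p 1 q →
      ∀ (v : HeightOneSpectrum (𝓞 K)), ((q : ℕ) : 𝓞 K) ∈ v.asIdeal →
      ∀ 𝔓 ∈ v.primesAbove, ∀ (φ : absoluteGaloisGroup K) (hφ : φ ∈ κ.kerSubgroup),
        φ ∈ 𝔓.decompositionSubgroup (absoluteGaloisGroup K) → IsArithFrobAt (𝓞 K) φ 𝔓 →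
        resOfLe (geomTorsion (W.baseChange K) ((p : ℤ) ^ 1))
          ((Subgroup.zpowers_le.mpr hφ).trans (κ.kerSubgroup_le_layerSubgroup 0)) x = 0) :
    x = 0 := by
  by_contra hx
  have hN' : N = W.conductorNorm ℤ := by exact_mod_cast hN
  have hH : SatisfiesHeegnerHypothesis (W.conductorNorm ℤ) K := fun ℓ hℓ hℓN ↦ hHeeg ℓ hℓ (hN' ▸ hℓN)
  obtain ⟨q, hadm, v, hqv, 𝔓, h𝔓, φ, hφ, hφD, hφF, hne⟩ :=
    exists_admissibleFrob_resOfLe_ne_zero h5 hsurj hK hH hsp κ hκ x hx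
  exact hne (hinv q (hN' ▸ hadm) v hqv 𝔓 h𝔓 φ hφ hφD hφF)

end Main

end Summit.BirchSwinnertonDyer.BirchSwinnertonDyer.Theorems.SignedBaseChangeAcDivAdmdefRootZero

end
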